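import Mathlib
import Summits.PneNP.PneNP.Theorems.PositionalGamesMpgHardNpLanguageDefs

/-!
# Route PositionalGames — support item `MpgHardNpLanguage` (stmt-PneNP-1300): potentials from the cycle condition

Helper file (the completeness half of the NP certificate) for the proof of
`Summit.PneNP.PneNP.Theses.PositionalGames.MpgHardNpLanguage`.

Setting: a successor relation `E` on `Fin n` in which every vertex has a successor (the arena
left to player Odd once Even has fixed a positional strategy: Even vertices keep one edge, Odd
vertices all their legal edges), integer vertex weights `c`, a start vertex `v`, and the
hypothesis that for EVERY choice function `f ⊆ E` the cycle of the lasso `t ↦ f^[t] v` has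
non-negative total weight (stated on a repetition window `[i, j)` before which the orbit is
injective, `CycleCondition`). Conclusion (`exists_potential`): there are a set `R ∋ v` closed under
`E`-successors and an integer potential `φ`, bounded by `n · B` when `|c| ≤ B`, with
`φ w ≤ φ u + c u` for every edge `u → w` leaving `R` — the shortest-simple-path potential
(Bellman–Ford feasibility; `φ u` = least weight of a simple `E`-path from `v` to `u`, paths as
injective finite sequences `ℕ → Fin n`; definitions `IsPath`, `pathWt`, `CycleCondition`,
`pathWts` in `…Defs.lean`). The only non-trivial step (`sum_Ico_nonneg_of_back_edge`)
closes a simple path by a back edge into the lasso of an explicit choice function and reads the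
hypothesis. Zwick–Paterson 1996, §2 / folklore (potential = shortest distances when no negative
cycle is reachable).
-/

namespace Summit.PneNP.PneNP.Theorems.MpgNP

set_option linter.dupNamespace false -- `Summit.PneNP.PneNP.…`: summit = sub-problem (D-0017)

open Finset

variable {n : ℕ}

/-- A simple path has fewer edges than there are vertices. [folklore] -/
theorem IsPath.lt {E : Fin n → Fin n → Prop} {v u : Fin n} {a : ℕ → Fin n} {k : ℕ}
    (h : IsPath E v u a k) : k < n := by
  have hinj : Function.Injective (fun t : Fin (k + 1) => a t) := by
    intro s t hst
    exact Fin.ext (h.2.2.2 s t (Nat.lt_succ_iff.1 s.2) (Nat.lt_succ_iff.1 t.2) hst)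
  have := Fintype.card_le_of_injective _ hinj
  simp only [Fintype.card_fin] at this
  omega

/-- Weight bound for simple paths: `|W(a)| ≤ n · B` if `|c| ≤ B`. [folklore] -/
theorem IsPath.abs_pathWt_le {E : Fin n → Fin n → Prop} {v u : Fin n} {a : ℕ → Fin n} {k : ℕ}
    (h : IsPath E v u a k) {c : Fin n → ℤ} {B : ℤ} (hB : ∀ u, |c u| ≤ B) :
    |pathWt c a k| ≤ n * B := by
  have hk := h.lt
  have hB0 : 0 ≤ B := (abs_nonneg _).trans (hB v)
  calc |pathWt c a k| ≤ ∑ t ∈ range k, |c (a t)| := abs_sum_le_sum_abs _ _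
    _ ≤ ∑ _t ∈ range k, B := sum_le_sum fun t _ => hB _
    _ = k * B := by simp
    _ ≤ n * B := by
      have : (k : ℤ) ≤ n := by exact_mod_cast hk.le
      nlinarith

/-- The trivial path at `v`. [folklore] -/
theorem isPath_zero (E : Fin n → Fin n → Prop) (v : Fin n) : IsPath E v v (fun _ => v) 0 :=
  ⟨rfl, rfl, fun t ht => absurd ht (Nat.not_lt_zero t), fun s t hs ht _ => by omega⟩

/-- Prefixes of simple paths are simple paths. [folklore] -/
theorem IsPath.prefix {E : Fin n → Fin n → Prop} {v u : Fin n} {a : ℕ → Fin n} {k : ℕ}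
    (h : IsPath E v u a k) {i : ℕ} (hi : i ≤ k) : IsPath E v (a i) a i :=
  ⟨h.1, rfl, fun t ht => h.2.2.1 t (by omega), fun s t hs ht hst => h.2.2.2 s t (by omega) (by omega) hst⟩

/-- Extending a simple path by an edge to a NEW vertex gives a simple path. [folklore] -/
theorem IsPath.extend {E : Fin n → Fin n → Prop} {v u : Fin n} {a : ℕ → Fin n} {k : ℕ}
    (h : IsPath E v u a k) {w : Fin n} (hE : E u w) (hnew : ∀ t, t ≤ k → a t ≠ w) :
    IsPath E v w (fun t => if t ≤ k then a t else w) (k + 1) := by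
  obtain ⟨h0, hk, hedge, hinj⟩ := h
  refine ⟨by simp [h0], by simp, fun t ht => ?_, fun s t hs ht hst => ?_⟩
  · dsimp only
    by_cases htk : t < k
    · rw [if_pos htk.le, if_pos (by omega)]
      exact hedge t htk
    · have htk' : t = k := by omega
      rw [if_pos (by omega), if_neg (by omega), htk', hk]
      exact hE
  · dsimp only at hst
    by_cases hs' : s ≤ k <;> by_cases ht' : t ≤ k
    · rw [if_pos hs', if_pos ht'] at hst
      exact hinj s t hs' ht' hst
    · rw [if_pos hs', if_neg ht'] at hst
      exact absurd hst (hnew s hs')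
    · rw [if_neg hs', if_pos ht'] at hst
      exact absurd hst.symm (hnew t ht')
    · omega

/-- Weight of the extended path: `W + c u`. [folklore] -/
theorem pathWt_extend (c : Fin n → ℤ) (a : ℕ → Fin n) (k : ℕ) (w : Fin n) :
    pathWt c (fun t => if t ≤ k then a t else w) (k + 1) = pathWt c a k + c (a k) := by
  rw [pathWt, pathWt, sum_range_succ, if_pos le_rfl]
  congr 1
  exact sum_congr rfl fun t ht => by rw [if_pos (mem_range.1 ht).le]

/-- **Closing a simple path by a back edge.** If a simple path `a₀ = v, …, a_k` has a back edge
`a_k → a_i` (`i ≤ k`) then, under the cycle condition, the cycle `a_i, …, a_k` has non-negative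
weight: `0 ≤ Σ_{t ∈ [i, k+1)} c (a t)`. (The path followed by the back edge is the lasso of the
choice function "next vertex on the path, `a_i` after `a_k`, any successor elsewhere".)
[folklore] -/
theorem sum_Ico_nonneg_of_back_edge {E : Fin n → Fin n → Prop} (htot : ∀ u, ∃ w, E u w)
    {c : Fin n → ℤ} {v u : Fin n} (hcyc : CycleCondition E c v) {a : ℕ → Fin n} {k : ℕ}
    (h : IsPath E v u a k) {i : ℕ} (hi : i ≤ k) (hback : E u (a i)) :
    0 ≤ ∑ t ∈ Ico i (k + 1), c (a t) := by
  classical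
  obtain ⟨h0, hk, hedge, hinj⟩ := h
  choose succ hsucc using htot
  -- the choice function realising the lasso
  let f : Fin n → Fin n := fun z =>
    if hz : ∃ t, t < k ∧ a t = z then a (Classical.choose hz + 1)
    else if z = a k then a i else succ z
  have hf_lt : ∀ t, t < k → f (a t) = a (t + 1) := by
    intro t ht
    have hz : ∃ t', t' < k ∧ a t' = a t := ⟨t, ht, rfl⟩
    have h1 : f (a t) = a (Classical.choose hz + 1) := by
      simp only [f, dif_pos hz]
    have h2 : Classical.choose hz = t :=
      hinj _ _ (Classical.choose_spec hz).1.le ht.le (Classical.choose_spec hz).2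
    rw [h1, h2]
  have hf_k : f (a k) = a i := by
    have hz : ¬ ∃ t', t' < k ∧ a t' = a k := by
      rintro ⟨t', ht', he⟩
      have := hinj _ _ ht'.le le_rfl he
      omega
    simp only [f, dif_neg hz, if_true]
  have hfE : ∀ z, E z (f z) := by
    intro z
    by_cases hz : ∃ t, t < k ∧ a t = z
    · obtain ⟨t, ht, rfl⟩ := hz
      rw [hf_lt t ht]
      exact hedge t ht
    · by_cases hzk : z = a k
      · rw [hzk, hf_k, hk]
        exact hback
      · have : f z = succ z := by simp only [f, dif_neg hz, if_neg hzk]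
        rw [this]
        exact hsucc z
  -- the orbit follows the path, then jumps back to `a i`
  have horbit : ∀ t, t ≤ k → f^[t] v = a t := by
    intro t
    induction t with
    | zero => intro; simp [h0]
    | succ t ih =>
      intro ht
      rw [Function.iterate_succ_apply', ih (by omega), hf_lt t (by omega)]
  have horbit' : f^[k + 1] v = a i := by
    rw [Function.iterate_succ_apply', horbit k le_rfl, hf_k]
  have hwin := hcyc f hfE i (k + 1) (by omega) (by rw [horbit i hi, horbit'])
    (fun s t hs ht hst => by
      rw [horbit s (by omega), horbit t (by omega)] at hst
      exact hinj s t (by omega) (by omega) hst)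
  refine hwin.trans_eq (sum_congr rfl fun t ht => ?_)
  rw [horbit t (by have := (mem_Ico.1 ht).2; omega)]

/-- The weights of simple paths form a finite set (bounded integers). [folklore] -/
theorem pathWts_finite (E : Fin n → Fin n → Prop) (c : Fin n → ℤ) (v u : Fin n) :
    (pathWts E c v u).Finite := by
  let B : ℤ := ∑ z : Fin n, |c z|
  have hB : ∀ z, |c z| ≤ B := fun z =>
    single_le_sum (f := fun z => |c z|) (fun _ _ => abs_nonneg _) (mem_univ z)
  refine (Set.finite_Icc (-(n * B)) (n * B)).subset ?_
  rintro x ⟨a, k, hp, rfl⟩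
  exact Set.mem_Icc.2 (abs_le.1 (hp.abs_pathWt_le hB))

/-- **Potentials from the cycle condition** (completeness of the certificate). If every vertex
has an `E`-successor, `|c| ≤ B`, and the cycle condition holds at `v`, then there are a set `R`
of vertices and an integer potential `φ` with: `v ∈ R`; for every `u ∈ R` and every edge
`u → w`, `w ∈ R` and `φ w ≤ φ u + c u`; and `|φ u| ≤ n · B` for all `u`. (`R` = vertices
reachable by a simple path, `φ` = least simple-path weight, `0` off `R`.) [folklore] -/
theorem exists_potential (E : Fin n → Fin n → Prop) (htot : ∀ u, ∃ w, E u w) (c : Fin n → ℤ)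
    (B : ℤ) (hB : ∀ u, |c u| ≤ B) (v : Fin n) (hcyc : CycleCondition E c v) :
    ∃ (R : Set (Fin n)) (φ : Fin n → ℤ), v ∈ R ∧
      (∀ u ∈ R, ∀ w, E u w → w ∈ R ∧ φ w ≤ φ u + c u) ∧ ∀ u, |φ u| ≤ n * B := by
  classical
  let R : Set (Fin n) := {u | (pathWts E c v u).Nonempty}
  have hfin : ∀ u, (pathWts E c v u).Finite := pathWts_finite E c v
  let φ : Fin n → ℤ := fun u =>
    if hu : (pathWts E c v u).Nonempty then ((hfin u).toFinset).min' (by simpa using hu) else 0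
  have hφmem : ∀ u (hu : (pathWts E c v u).Nonempty), φ u ∈ pathWts E c v u := by
    intro u hu
    have : φ u = ((hfin u).toFinset).min' (by simpa using hu) := by simp only [φ, dif_pos hu]
    rw [this]
    exact (hfin u).mem_toFinset.1 (Finset.min'_mem _ _)
  have hφle : ∀ u x, x ∈ pathWts E c v u → φ u ≤ x := by
    intro u x hx
    have hu : (pathWts E c v u).Nonempty := ⟨x, hx⟩
    have : φ u = ((hfin u).toFinset).min' (by simpa using hu) := by simp only [φ, dif_pos hu]
    rw [this]
    exact Finset.min'_le _ _ ((hfin u).mem_toFinset.2 hx)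
  refine ⟨R, φ, ⟨0, fun _ => v, 0, isPath_zero E v, by simp [pathWt]⟩, ?_, ?_⟩
  · intro u hu w hE
    obtain ⟨a, k, hp, hwt⟩ := hφmem u hu
    by_cases hmem : ∃ i, i ≤ k ∧ a i = w
    · -- back edge: the prefix up to `w` is a simple path, and the closed cycle is non-negative
      obtain ⟨i, hi, rfl⟩ := hmem
      have hpre := hp.prefix hi
      have hwR : pathWt c a i ∈ pathWts E c v (a i) := ⟨a, i, hpre, rfl⟩
      refine ⟨⟨_, hwR⟩, (hφle _ _ hwR).trans ?_⟩
      have hnn := sum_Ico_nonneg_of_back_edge htot hcyc hp hi hE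
      rw [← hwt, pathWt, pathWt, ← hp.2.1]
      rw [Finset.sum_Ico_eq_sub _ (by omega : i ≤ k + 1), sum_range_succ] at hnn
      linarith
    · -- new vertex: extend the path
      push Not at hmem
      have hext := hp.extend hE fun t ht => hmem t ht
      have hwR : pathWt c a k + c (a k) ∈ pathWts E c v w :=
        ⟨_, k + 1, hext, pathWt_extend c a k w⟩
      refine ⟨⟨_, hwR⟩, (hφle _ _ hwR).trans ?_⟩
      rw [← hwt, hp.2.1]
  · intro u
    by_cases hu : (pathWts E c v u).Nonempty
    · obtain ⟨a, k, hp, hwt⟩ := hφmem u hu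
      rw [← hwt]
      exact hp.abs_pathWt_le hB
    · have : φ u = 0 := by simp only [φ, dif_neg hu]
      rw [this, abs_zero]
      exact mul_nonneg (by positivity) ((abs_nonneg _).trans (hB v))
end Summit.PneNP.PneNP.Theorems.MpgNP
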